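import Summits.NavierStokesRegularity.FluidComputer.ClayBlowupFarField
import Summits.NavierStokesRegularity.FluidComputer.ClayBlowupLifespan
import HarnessLib

/-!
# A Clay blow-up has a SINGULAR POINT on its final slice, inside a fixed ball; and the (A)-side
# reading of the type identification: Clay (A) ⟺ no UNFORCED designed blow-up

Cell `ns-blowup`, seat `ns-blowup-ecbridge-2` (g6; the E–C endpoint theory seat). LABEL: E–C typing
(KERNEL — no named fact). WHAT THIS IS NOT: not Navier–Stokes evidence — statements about TYPES nobody
has inhabited; nothing is constructed; neither side of any `↔` is asserted. Companion memo:
`run/shared/lean/pub/ns-blowup/ecbridge2/ECBRIDGE-2-MEMO-5.md` §4 (i), (v).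

## Content

* §1 `navierStokesRegularity_iff_forall_designedBlowup_force_ne_zero` — Clay (A) holds iff every DESIGNED
  blow-up (at every / equivalently, by `toDesignedBlowup`, every Clay blow-up) has a nonzero force
  (g5's `navierStokesRegularity_iff_forall_clayBlowup_force_ne_zero` transported along the g6
  identification of the types `ClayBlowup.toDesignedBlowup` / `DesignedBlowup.toClayBlowup`);
  `regularity_and_breakdown_iff_designed` — (A) ∧ (C) ⟺ some designed blow-up exists ∧ none is unforced.
* §2 **`ClayBlowup.exists_not_isBackwardBoundedAt`** — every Clay blow-up at `ν > 0` has a SINGULAR POINT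
  `(T, x₀)` in the sense of the tree's `IsBackwardBoundedAt` (Seregin–Šverák / Escauriaza–Seregin–Šverák:
  `u` unbounded on every backward cylinder `(T - r², T) × B(x₀, r)`), and every such point lies in the
  far-field ball: `‖x₀‖ ≤ R` (`exists_singularPoint`). Proof: if every point of the final slice were
  backward bounded, compactness of `[3T/4, T] × B̄(0, R)` (`SereginSverak2002.nearField_bound`), the
  far-field bound (`exists_farField_bound`) and the bound on `[0, 3T/4]` (`exists_norm_le`) would bound
  `u` on `[0, T) × ℝ³`, contradicting `exists_norm_gt` (the `L^∞` blow-up criterion on the type).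

References: L. Escauriaza, G. Seregin, V. Šverák, Russ. Math. Surveys 58 (2003) §3 (3.5)–(3.6)
[cite: EscauriazaSereginSverak2003, §3]; C. L. Fefferman, Clay problem description, (A), (C)
[cite: FeffermanClay2006, (A) (C)]; P. G. Lemarié-Rieusset (2016), Thm. 11.2 and proof of Thm. 14.5
[cite: LemarieRieusset2016, Thm. 11.2].
-/

noncomputable section

namespace Summit.NavierStokesRegularity.FluidComputer

open Set MeasureTheory Filter Topology Function TopologicalSpace Metric
open scoped ENNReal ContDiff NNReal
open Literature.Analysis.FluidPDE
open Summit.NavierStokesRegularity.NavierStokesRegularity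
open Summit.NavierStokesRegularity.FluidComputer.PalasekTowerClayBridge

/-! ## §1 Clay (A) ⟺ no unforced designed blow-up -/

/-- **CLAY (A) ⟺ EVERY DESIGNED BLOW-UP HAS A NONZERO FORCE** (at every viscosity): the g5 reading
«(A) ⟺ no unforced Clay blow-up» transported along `ClayBlowup.toDesignedBlowup` /
`DesignedBlowup.toClayBlowup`. Neither side is asserted. [cite: FeffermanClay2006, (A)] -/
theorem navierStokesRegularity_iff_forall_designedBlowup_force_ne_zero :
    _root_.NavierStokesRegularity ↔ ∀ ν : ℝ, 0 < ν → ∀ D : DesignedBlowup ν, D.f ≠ 0 := by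
  rw [navierStokesRegularity_iff_forall_clayBlowup_force_ne_zero]
  constructor
  · intro h ν hν D
    exact h ν hν D.toClayBlowup
  · intro h ν hν X
    exact h ν hν (X.toDesignedBlowup hν)

/-- **(A) ∧ (C) ⟺ some designed blow-up exists and none is unforced** («forcing creates a finite
lifespan that unforced Clay data never have», on the designed type). Neither side is asserted.
[cite: FeffermanClay2006, (A) (C)] -/
theorem regularity_and_breakdown_iff_designed :
    (_root_.NavierStokesRegularity ∧ NavierStokesRegularity.NavierStokesBreakdownR3) ↔
      (∃ ν : ℝ, 0 < ν ∧ Nonempty (DesignedBlowup ν)) ∧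
        ∀ ν : ℝ, 0 < ν → ∀ D : DesignedBlowup ν, D.f ≠ 0 := by
  rw [navierStokesRegularity_iff_forall_designedBlowup_force_ne_zero,
    navierStokesBreakdownR3_iff_exists_nonempty_designedBlowup]
  exact and_comm

namespace ClayBlowup

variable {ν : ℝ} (X : ClayBlowup ν)

/-! ## §2 A singular point on the final slice, inside the far-field ball -/

/-- **Points of the final slice beyond the far-field radius are backward bounded**: if
`‖u(t, x)‖ ≤ M` for `T/2 < t < T`, `|x| > R`, then `u` is bounded on the backward cylinder
`(T - r², T) × B(x₀, r)` at every `x₀` with `|x₀| > R`, for `r = min (|x₀| - R) √(T/2)`.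
[cite: EscauriazaSereginSverak2003, §3] -/
theorem isBackwardBoundedAt_of_farField {R M : ℝ}
    (h : ∀ t ∈ Ioo (X.T / 2) X.T, ∀ x : EuclideanSpace ℝ (Fin 3), R < ‖x‖ → ‖X.u t x‖ ≤ M)
    {x₀ : EuclideanSpace ℝ (Fin 3)} (hx₀ : R < ‖x₀‖) : IsBackwardBoundedAt X.u X.T x₀ := by
  have hT := X.T_pos
  set r : ℝ := min (‖x₀‖ - R) (Real.sqrt (X.T / 2)) with hr
  have hr0 : 0 < r := lt_min (sub_pos.2 hx₀) (Real.sqrt_pos.2 (by positivity))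
  have hrsq : r ^ 2 ≤ X.T / 2 := by
    calc r ^ 2 ≤ Real.sqrt (X.T / 2) ^ 2 := pow_le_pow_left₀ hr0.le (min_le_right _ _) 2
      _ = X.T / 2 := Real.sq_sqrt (by positivity)
  refine ⟨r, hr0, M, fun t ht x hx => h t ⟨by linarith [ht.1], ht.2⟩ x ?_⟩
  rw [mem_ball, dist_eq_norm] at hx
  have h1 := norm_sub_norm_le x₀ x
  rw [← norm_neg (x₀ - x), neg_sub] at h1
  have h2 : r ≤ ‖x₀‖ - R := min_le_left _ _
  linarith

/-- **EVERY CLAY BLOW-UP HAS A SINGULAR POINT ON ITS FINAL SLICE** (`ν > 0`): some `x₀` at which `u` is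
NOT backward bounded at time `T` — `u` is unbounded on every backward cylinder `(T - r², T) × B(x₀, r)`.
Proof: were every point backward bounded, compactness (`SereginSverak2002.nearField_bound` on
`[3T/4, T] × B̄(0, R)`), the far-field bound (`exists_farField_bound`) and the bound on `[0, 3T/4]`
(`exists_norm_le`) would bound `u` on `[0, T) × ℝ³`, against the `L^∞` blow-up criterion on the type
(`exists_norm_gt`). No named fact. [cite: LemarieRieusset2016, Thm. 11.2] [cite: EscauriazaSereginSverak2003, §3] -/
theorem exists_not_isBackwardBoundedAt (hν : 0 < ν) :
    ∃ x₀ : EuclideanSpace ℝ (Fin 3), ¬ IsBackwardBoundedAt X.u X.T x₀ := by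
  have hT := X.T_pos
  by_contra hall
  push Not at hall
  obtain ⟨R, Mf, hfar⟩ := X.exists_farField_bound hν
  obtain ⟨Mn, hnear⟩ := SereginSverak2002.nearField_bound hT
    X.classical.smooth_velocity.continuousOn hall (δ := 3 * X.T / 4) (by positivity) R
  obtain ⟨B, hB⟩ := X.exists_norm_le hν (show 3 * X.T / 4 < X.T by linarith)
  obtain ⟨t, ht, x, hx⟩ := X.exists_norm_gt hν (max Mf (max Mn B))
  rcases le_or_gt t (3 * X.T / 4) with hle | hgt
  · -- early times
    exact absurd (hB t ⟨ht.1, hle⟩ x) (not_le.2 (lt_of_le_of_lt (le_max_of_le_right (le_max_right _ _)) hx))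
  · rcases le_or_gt ‖x‖ R with hxR | hxR
    · -- near field
      have h := hnear (t, x) ⟨⟨hgt.le, ht.2.le⟩, mem_closedBall_zero_iff.2 hxR⟩ ht.2
      exact absurd h (not_le.2 (lt_of_le_of_lt (le_max_of_le_right (le_max_left _ _)) hx))
    · -- far field
      have h := hfar t ⟨by linarith, ht.2⟩ x hxR
      exact absurd h (not_le.2 (lt_of_le_of_lt (le_max_left _ _) hx))

/-- **THE SINGULAR POINTS OF THE FINAL SLICE LIE IN A FIXED BALL, AND THERE IS ONE**: for a Clay blow-up
at `ν > 0` there is `R` such that every `x₀` with `|x₀| > R` is backward bounded at time `T`, and some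
`x₀` with `|x₀| ≤ R` is not. No named fact. [cite: LemarieRieusset2016, Thm. 11.2 and proof of Thm. 14.5 (p. 512)] -/
theorem exists_singularPoint (hν : 0 < ν) :
    ∃ R : ℝ, (∀ x₀ : EuclideanSpace ℝ (Fin 3), R < ‖x₀‖ → IsBackwardBoundedAt X.u X.T x₀) ∧
      ∃ x₀ : EuclideanSpace ℝ (Fin 3), ‖x₀‖ ≤ R ∧ ¬ IsBackwardBoundedAt X.u X.T x₀ := by
  obtain ⟨R, M, hfar⟩ := X.exists_farField_bound hν
  obtain ⟨x₀, hx₀⟩ := X.exists_not_isBackwardBoundedAt hν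
  refine ⟨R, fun y hy => X.isBackwardBoundedAt_of_farField hfar hy, x₀, ?_, hx₀⟩
  by_contra hlt
  exact hx₀ (X.isBackwardBoundedAt_of_farField hfar (not_le.1 hlt))

/-- **Backward boundedness is an open condition on the slice**: if `u` is bounded on
`(t₀ - r², t₀) × B(x₀, r)` then it is bounded on `(t₀ - (r/2)², t₀) × B(y, r/2)` for every
`y ∈ B(x₀, r/2)`. [folklore] -/
theorem _root_.Summit.NavierStokesRegularity.FluidComputer.isOpen_setOf_isBackwardBoundedAt
    (u : ℝ → EuclideanSpace ℝ (Fin 3) → EuclideanSpace ℝ (Fin 3)) (t₀ : ℝ) :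
    IsOpen {x₀ : EuclideanSpace ℝ (Fin 3) | IsBackwardBoundedAt u t₀ x₀} := by
  rw [Metric.isOpen_iff]
  rintro x₀ ⟨r, hr, C, hC⟩
  refine ⟨r / 2, by positivity, fun y hy => ⟨r / 2, by positivity, C, fun t ht x hx => hC t ?_ x ?_⟩⟩
  · exact ⟨by nlinarith [ht.1], ht.2⟩
  · rw [mem_ball] at hx hy ⊢
    linarith [dist_triangle x y x₀]

/-- **THE SINGULAR SLICE OF A CLAY BLOW-UP IS A NONEMPTY COMPACT SET**: at `ν > 0`,
`{x₀ | u is not backward bounded at (T, x₀)}` is compact (closed, inside `B̄(0, R)`) and nonempty.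
No named fact. [cite: LemarieRieusset2016, Thm. 11.2 and proof of Thm. 14.5 (p. 512)]
[cite: CaffarelliKohnNirenberg1982, §6] -/
theorem isCompact_singularSlice (hν : 0 < ν) :
    IsCompact {x₀ : EuclideanSpace ℝ (Fin 3) | ¬ IsBackwardBoundedAt X.u X.T x₀} ∧
      {x₀ : EuclideanSpace ℝ (Fin 3) | ¬ IsBackwardBoundedAt X.u X.T x₀}.Nonempty := by
  obtain ⟨R, hreg, x₀, -, hx₀⟩ := X.exists_singularPoint hν
  refine ⟨(isCompact_closedBall (0 : EuclideanSpace ℝ (Fin 3)) R).of_isClosed_subset ?_ ?_, x₀, hx₀⟩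
  · rw [← isOpen_compl_iff]
    have e : {x₀ : EuclideanSpace ℝ (Fin 3) | ¬ IsBackwardBoundedAt X.u X.T x₀}ᶜ =
        {x₀ : EuclideanSpace ℝ (Fin 3) | IsBackwardBoundedAt X.u X.T x₀} := by
      ext y; simp
    rw [e]
    exact isOpen_setOf_isBackwardBoundedAt X.u X.T
  · intro y hy
    rw [mem_closedBall, dist_zero_right]
    by_contra hlt
    exact hy (hreg y (not_le.1 hlt))

end ClayBlowup

end Summit.NavierStokesRegularity.FluidComputer

end
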